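import Literature.Algebra.Homology.DiscreteRepStandardResolutionRestriction
import Literature.Algebra.Homology.DiscreteRepClosedSubgroupCoindRes
import Literature.Algebra.Homology.DiscreteRepRestrictionExact

/-!
# The comparison `Extⁿ_{C_Γ}(k, X) ≅ Hⁿ_cont(Γ, X)` commutes with restriction to a CLOSED subgroup
# of a profinite group

Topic `Algebra/Homology`; namespace `Literature.Algebra.Homology.DiscreteRep`.  Sequel of
`DiscreteRepStandardResolutionRestriction` (the same statement for an OPEN subgroup of finite index),
`DiscreteRepClosedSubgroupCoindRes` (acyclicity of `Res_D CoInd_Γ V` for `D` closed, Serre I §2.5 via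
I §1.2 Prop. 1) and `DiscreteRepRestrictionExact` (`resD k D` is exact for every subgroup); theorems
only, no named fact, no `sorry`.

Let `Γ` be a PROFINITE group (compact, totally disconnected), `D ≤ Γ` a CLOSED subgroup (e.g. a
decomposition group `D_v ≤ G_S`, closed of infinite index), `k` a commutative ring and `X` a
topologically discrete `k`-linear `Γ`-representation with open stabilisers (`hX`).  With
`Φ_X : Extⁿ_{C_Γ}(k, X) ≃+ Hⁿ_cont(Γ, X)` the comparison of `DiscreteRepStandardResolution`:

**Theorem (`extTrivAddEquivContinuousCohomology_res_of_isClosed`).**  For `x ∈ Extⁿ_{C_Γ}(k, X)`,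

  `Hⁿ(res) (Φ_X x) = Φ_{Res_D X} (Res_D x)`,

`Hⁿ(res) = ContinuousCohomology.map (D ↪ Γ) (𝟙 (Res X))`, `Res_D x = Ext.mapExactFunctor (resD k D) x`.

The open-subgroup file uses openness/finite index in exactly one place, the `Ext_{C_U}(k, –)`-acyclicity
of `Res_U` of the terms `CoInd_Γ(…)` of the standard complex (Shapiro, `Coind_U^Γ ⊣ Res`); its §1–§2
(`stdComplexResMap`, `stdη_res`, `extComplexResMap`, `extComplexHomologyIso_res`) are stated for any
compact subgroup.  Here that one input is replaced by
`ext_triv_resD_eq_zero_of_iso_coind_of_isClosed` (the restriction of an induced module to a closed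
subgroup is induced), and the gluing of §3 there is repeated verbatim.
(`CompactSpace D` is carried as an instance hypothesis so that `C_D`-objects are stated uniformly; it
follows from `IsClosed D`.)

## References
* D. Harari, *Galois Cohomology and Class Field Theory*, Springer (2020), §4.3 Remark 4.24 and item (2),
  §1.5 Definition 1.33 (restriction). [Harari2020]
* J.-P. Serre, *Galois Cohomology*, Springer (1997), I §1.2 Proposition 1, I §2.5. [SerreGaloisCohomology1997]
-/

noncomputable section

universe u

namespace Literature.Algebra.Homology

namespace DiscreteRep

open CategoryTheory CategoryTheory.Limits CategoryTheory.Abelian TopRep ContRepresentation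
  ContinuousCohomology

variable {k Γ : Type u} [CommRing k] [TopologicalSpace k] [Group Γ] [TopologicalSpace Γ]
  [IsTopologicalGroup Γ] [CompactSpace Γ] [TotallyDisconnectedSpace Γ] (D : Subgroup Γ)
  (hD : IsClosed (D : Set Γ)) [CompactSpace D]
  {X : TopRep.{u} k Γ} [DiscreteTopology X.V] (hX : IsDiscrete ((forgetTop k Γ).obj X))

include hD in
/-- **`Res_D(std_Γ X)` is `Ext_{C_D}(k, –)`-acyclic for `D` closed** (its terms are restrictions to `D`
of co-induced modules, which are co-induced for `D`).
[cite: SerreGaloisCohomology1997, I §2.5] -/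
theorem ext_triv_resD_stdComplex_X_eq_zero_of_isClosed (n q : ℕ)
    (e : Ext (triv (k := k) (Γ := D) k)
      ((AcyclicResolution.mapComplex (resD k D) (stdComplex X hX)).X n) (q + 1)) : e = 0 :=
  haveI := discreteTopology_resolutionX X n
  ext_triv_resD_eq_zero_of_iso_coind_of_isClosed D hD (stdObjSuccIso X hX n) q e

include hD in
/-- The abstract identifications `Extⁿ(k, ·) ≃+ Hⁿ(Ext⁰(k, std))` over `Γ` and over the closed
subgroup `D` are intertwined by `Res_D` and `Hⁿ(extComplexResMap)` (gluing of
`DiscreteRepStandardResolutionRestriction` §3 with the closed-subgroup acyclicity input).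
[cite: Harari2020, §4.3 Remark 4.24] -/
theorem extTrivAddEquivExtComplexHomology_res_of_isClosed (n : ℕ)
    (x : Ext (triv (Γ := Γ) k) (stdBase X hX) n) :
    (HomologicalComplex.homologyMap (extComplexResMap D hX) n).hom
        (extTrivAddEquivExtComplexHomology X hX n x) =
      extTrivAddEquivExtComplexHomology (resTop D X) (isDiscrete_resTop D hX) n
        (x.mapExactFunctor (resD k D)) := by
  -- the engine's `Mono` instances, registered locally (no reducibility tweaks)
  haveI : Mono (stdη X hX) := mono_stdη X hX
  haveI : Mono ((resD k D).map (stdη X hX)) := (resD k D).map_mono (stdη X hX)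
  haveI := AcyclicResolution.mono_map_augmentation (resD k D) (stdComplex X hX) (stdη X hX)
  haveI : Mono (stdη (resTop D X) (isDiscrete_resTop D hX)) := mono_stdη (resTop D X) (isDiscrete_resTop D hX)
  unfold extComplexResMap
  rw [HomologicalComplex.homologyMap_comp]
  change (HomologicalComplex.homologyMap
      (AcyclicResolution.extComplexMap (triv (Γ := D) k) (stdComplexResMap D hX)) n).hom
      ((HomologicalComplex.homologyMap (AcyclicResolution.extComplexMapF (resD k D) (triv (Γ := Γ) k)
        (stdComplex X hX)) n).hom (extTrivAddEquivExtComplexHomology X hX n x)) = _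
  cases n with
  | zero =>
    have hA := AcyclicResolution.extAddEquivHomologyZero_map (resD k D) (triv (Γ := Γ) k)
      (stdComplex X hX) (stdη X hX) (stdη_d X hX) (exact_stdη X hX) x
    have hB := AcyclicResolution.extAddEquivHomologyZero_naturality (triv (Γ := D) k)
      (stdComplexResMap D hX) ((resD k D).map (stdη X hX))
      (AcyclicResolution.map_hη (resD k D) (stdComplex X hX) (stdη X hX) (stdη_d X hX))
      (AcyclicResolution.map_exact_augmentation (resD k D) (stdComplex X hX) (stdη X hX) (stdη_d X hX)
        (exact_stdη X hX))
      (stdη (resTop D X) (isDiscrete_resTop D hX)) (stdη_d (resTop D X) (isDiscrete_resTop D hX))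
      (exact_stdη (resTop D X) (isDiscrete_resTop D hX)) (𝟙 _) (stdη_res D hX)
      (x.mapExactFunctor (resD k D))
    exact ((congrArg _ hA).trans hB).trans
      (congrArg (extTrivAddEquivExtComplexHomology (resTop D X) (isDiscrete_resTop D hX) 0)
        (Ext.comp_mk₀_id _))
  | succ n =>
    have hA := AcyclicResolution.extAddEquivHomologySucc_map (resD k D) (triv (Γ := Γ) k)
      (stdComplex X hX) (stdη X hX) (stdη_d X hX) (exact_stdη X hX) (stdComplex_exactAt_succ X hX)
      (ext_triv_stdComplex_X_eq_zero X hX) (ext_triv_resD_stdComplex_X_eq_zero_of_isClosed D hD hX) n x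
    have hB := AcyclicResolution.extAddEquivHomologySucc_naturality (triv (Γ := D) k)
      (stdComplexResMap D hX) ((resD k D).map (stdη X hX))
      (AcyclicResolution.map_hη (resD k D) (stdComplex X hX) (stdη X hX) (stdη_d X hX))
      (AcyclicResolution.map_exact_augmentation (resD k D) (stdComplex X hX) (stdη X hX) (stdη_d X hX)
        (exact_stdη X hX))
      (stdη (resTop D X) (isDiscrete_resTop D hX)) (stdη_d (resTop D X) (isDiscrete_resTop D hX))
      (exact_stdη (resTop D X) (isDiscrete_resTop D hX)) (𝟙 _) (stdη_res D hX)
      (AcyclicResolution.map_exactAt (resD k D) (stdComplex X hX) (stdComplex_exactAt_succ X hX))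
      (ext_triv_resD_stdComplex_X_eq_zero_of_isClosed D hD hX)
      (stdComplex_exactAt_succ (resTop D X) (isDiscrete_resTop D hX))
      (ext_triv_stdComplex_X_eq_zero (resTop D X) (isDiscrete_resTop D hX)) n
      (x.mapExactFunctor (resD k D))
    exact ((congrArg _ hA).trans hB).trans
      (congrArg (extTrivAddEquivExtComplexHomology (resTop D X) (isDiscrete_resTop D hX) (n + 1))
        (Ext.comp_mk₀_id _))

include hD in
/-- **THE COMPARISON COMMUTES WITH RESTRICTION TO A CLOSED SUBGROUP OF A PROFINITE GROUP.**  For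
`D ≤ Γ` closed and `x ∈ Extⁿ_{C_Γ}(k, X)`: `Hⁿ(res) (Φ_X x) = Φ_{Res_D X} (Res_D x)`, with `Hⁿ(res)`
Mathlib's `ContinuousCohomology.map (D ↪ Γ) (𝟙 (Res X)) : Hⁿ_cont(Γ, X) → Hⁿ_cont(D, Res X)` and
`Res_D x` the image under the exact restriction functor `resD k D : C_Γ ⥤ C_D` (`Ext.mapExactFunctor`).
Typical use: `Γ = G_S`, `D = D_v` a decomposition group. [cite: Harari2020, §4.3 (2) and Remark 4.24] -/
theorem extTrivAddEquivContinuousCohomology_res_of_isClosed (n : ℕ)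
    (x : Ext (triv (Γ := Γ) k) (stdBase X hX) n) :
    (ContinuousCohomology.map (inclT D) (X := X) (Y := resTop D X) (𝟙 _) n).hom
        (extTrivAddEquivContinuousCohomology X hX n x) =
      extTrivAddEquivContinuousCohomology (resTop D X) (isDiscrete_resTop D hX) n
        (x.mapExactFunctor (resD k D)) := by
  change ((extComplexHomologyIso X hX n).hom ≫ (forgetAb k).map
      (ContinuousCohomology.map (inclT D) (X := X) (Y := resTop D X) (𝟙 _) n)).hom
      (extTrivAddEquivExtComplexHomology X hX n x) =
    (extComplexHomologyIso (resTop D X) (isDiscrete_resTop D hX) n).hom.hom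
      (extTrivAddEquivExtComplexHomology (resTop D X) (isDiscrete_resTop D hX) n
        (x.mapExactFunctor (resD k D)))
  rw [← extComplexHomologyIso_res D hX, ← extTrivAddEquivExtComplexHomology_res_of_isClosed D hD hX]
  rfl

end DiscreteRep

end Literature.Algebra.Homology
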